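import Summits.QuantumFields.YangMills.Theorems.IR.ShellMaxCorrPoincare
import Literature.Probability.LatticeModels.GibbsExistenceCompact

/-!
# Crux `IR` (item stmt-QuantumFields-19354) — line «maximal correlation at one physical thickness»:
the BESSEL/SCHUR almost-orthogonality bound, and kernel averages `γ_Λ f` of a specification

Helper module for item `stmt-QuantumFields-19354` (`--supports … --as helper`; it closes nothing; lead prover
ym-ir-line-mxc-p1, g2).  Toolkit for input (B) of the g2 route to the registered stub
`ShellMaxCorr.stub_shellRung : ShellRung` (`Theorems/IR/ShellMaxCorrDefs.lean`), consumed by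
`Theorems/IR/ShellMaxCorrTransfer.lean` (the abstract maximal-correlation theorem).

* §1 `sum_sq_integral_mul_le` — **Bessel/Schur**: for bounded measurable `w` and a finite family `(u_i)` on a finite
  measure space whose Gram matrix has rows `∑_j |∫ u_i u_j| ≤ Λ`, `∑_i (∫ w u_i)² ≤ Λ ∫ w²` (the simplest
  Cotlar–Stein almost-orthogonality lemma: `∑ c_i² = ⟨w, ∑ c_i u_i⟩`, Cauchy–Schwarz, Schur's test); the centred
  identities `∫ f g − ∫ f ∫ g = ∫ (f − ∫f)(g − ∫g)` and `∫ f² − (∫ f)² = ∫ (f − ∫ f)²`.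
* §2 kernel averages `γ_Λ f (η) = ∫ f dγ_Λ(·|η)` of a specification `γ` (Georgii's sense,
  `Literature.Probability.LatticeModels.IsSpecification`): measurable (bounded: the tree's `IsSpecification.abs_integral_le`); **locality** `γ_Λ(·|η^{x←s}) = γ_Λ(·|η)`
  for `x ∈ Λ` (outside measurability); **pull-out** `γ_Λ(F g) = g · γ_Λ F` for `g` reading only `Λᶜ` (properness);
  the DLR identities `∫ (γ_Λ F) g dμ = ∫ F g dμ`, `∫ γ_Λ F dμ = ∫ F dμ` for a Gibbs measure `μ`, and
  `∫ Var_{γ_Λ(η)}(F) dμ(η) ≤ Var_μ(F)` (`integral_kernelVar_le`).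

HONEST FRAMING: abstract probability / measure theory; nothing here proves `ShellRung`, the loads, or any mass gap.

Refs: H.-O. Georgii, *Gibbs Measures and Phase Transitions* (2011), Def. 1.23, Rem. 1.20/1.24; S. Friedli,
Y. Velenik, *Statistical Mechanics of Lattice Systems* (2017), §6.3.1; M. Cotlar, Rev. Mat. Cuyana 1 (1955) 41 /
E. M. Stein, *Harmonic Analysis* (1993), Ch. VII §2 (almost orthogonality).
-/

set_option autoImplicit false

noncomputable section

open MeasureTheory ProbabilityTheory Finset Function Filter
open Literature.Probability.LatticeModels Literature.Probability.LatticeModels.DobrushinMetric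
open Summit.QuantumFields.YangMills.Cruxes.IR.CollarDecoupling (sq_integral_mul_le)

namespace Summit.QuantumFields.YangMills.Cruxes.IR.ShellMaxCorr.HeatBath

/-! ## §1 Bessel/Schur: almost-orthogonal families -/

section Bessel

variable {Ω : Type*} [MeasurableSpace Ω] (ν : Measure Ω) [IsFiniteMeasure ν]

/-- Bounded measurable real functions are integrable on a finite measure space. -/
theorem integrable_of_abs_le_const {u : Ω → ℝ} (hu : Measurable u) {M : ℝ} (hM : ∀ ω, |u ω| ≤ M) :
    Integrable u ν :=
  Integrable.of_bound hu.aestronglyMeasurable M (ae_of_all _ fun ω => by rw [Real.norm_eq_abs]; exact hM ω)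

/-- **Bessel/Schur inequality.**  For bounded measurable `w` and a finite family `(u_i)_{i∈s}` whose Gram matrix has
rows `∑_{j∈s} |∫ u_i u_j dν| ≤ Λ`, one has `∑_{i∈s} (∫ w u_i dν)² ≤ Λ ∫ w² dν`.  (With `c_i = ∫ w u_i`:
`∑ c_i² = ∫ w (∑ c_i u_i) ≤ ‖w‖ ‖∑ c_i u_i‖` and `‖∑ c_i u_i‖² ≤ ∑ |c_i||c_j| |⟨u_i,u_j⟩| ≤ Λ ∑ c_i²` by Schur.) -/
theorem sum_sq_integral_mul_le {ι : Type*} (s : Finset ι) {u : ι → Ω → ℝ} {w : Ω → ℝ}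
    (hum : ∀ i ∈ s, Measurable (u i)) (hwm : Measurable w) {Mu Mw : ℝ} (hMu : ∀ i ∈ s, ∀ ω, |u i ω| ≤ Mu)
    (hMw : ∀ ω, |w ω| ≤ Mw) {Λ : ℝ} (hΛ : 0 ≤ Λ) (hrow : ∀ i ∈ s, ∑ j ∈ s, |∫ ω, u i ω * u j ω ∂ν| ≤ Λ) :
    ∑ i ∈ s, (∫ ω, w ω * u i ω ∂ν) ^ 2 ≤ Λ * ∫ ω, w ω ^ 2 ∂ν := by
  classical
  set c : ι → ℝ := fun i => ∫ ω, w ω * u i ω ∂ν with hc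
  set T : ℝ := ∑ i ∈ s, c i ^ 2 with hT
  have hT0 : 0 ≤ T := sum_nonneg fun i _ => sq_nonneg _
  -- the combination `z = ∑ c_i u_i`
  set z : Ω → ℝ := fun ω => ∑ i ∈ s, c i * u i ω with hz
  have hzm : Measurable z := Finset.measurable_sum _ fun i hi => (hum i hi).const_mul _
  have hzb : ∀ ω, |z ω| ≤ ∑ i ∈ s, |c i| * Mu := fun ω => by
    refine (abs_sum_le_sum_abs _ _).trans (sum_le_sum fun i hi => ?_)
    rw [abs_mul]; exact mul_le_mul_of_nonneg_left (hMu i hi ω) (abs_nonneg _)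
  have hwu : ∀ i ∈ s, Integrable (fun ω => w ω * u i ω) ν := fun i hi =>
    integrable_of_abs_le_const ν (hwm.mul (hum i hi)) (M := Mw * Mu) fun ω => by
      rw [abs_mul]; exact mul_le_mul (hMw ω) (hMu i hi ω) (abs_nonneg _) ((abs_nonneg _).trans (hMw ω))
  have huu : ∀ i ∈ s, ∀ j ∈ s, Integrable (fun ω => u i ω * u j ω) ν := fun i hi j hj =>
    integrable_of_abs_le_const ν ((hum i hi).mul (hum j hj)) (M := Mu * Mu) fun ω => by
      rw [abs_mul]; exact mul_le_mul (hMu i hi ω) (hMu j hj ω) (abs_nonneg _) ((abs_nonneg _).trans (hMu i hi ω))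
  -- `T = ∫ w z`
  have hTz : T = ∫ ω, w ω * z ω ∂ν := by
    simp only [hT, hz, mul_sum]
    rw [integral_finsetSum _ fun i hi => (hwu i hi).const_mul (c i) |>.congr (ae_of_all _ fun ω => by ring)]
    refine sum_congr rfl fun i hi => ?_
    rw [pow_two, hc]
    simp only
    rw [← integral_const_mul]
    exact integral_congr_ae (ae_of_all _ fun ω => by ring)
  -- `∫ z² ≤ Λ T` (Schur)
  have hzz : ∫ ω, z ω ^ 2 ∂ν ≤ Λ * T := by
    have hexp : ∫ ω, z ω ^ 2 ∂ν = ∑ i ∈ s, ∑ j ∈ s, c i * c j * ∫ ω, u i ω * u j ω ∂ν := by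
      have hpt : (fun ω => z ω ^ 2) = fun ω => ∑ i ∈ s, ∑ j ∈ s, c i * c j * (u i ω * u j ω) := by
        funext ω; simp only [hz, pow_two, sum_mul, mul_sum]; exact sum_congr rfl fun i _ =>
          sum_congr rfl fun j _ => by ring
      rw [hpt, integral_finsetSum _ fun i hi => integrable_finsetSum _ fun j hj =>
        (huu i hi j hj).const_mul _]
      refine sum_congr rfl fun i hi => ?_
      rw [integral_finsetSum _ fun j hj => (huu i hi j hj).const_mul _]
      exact sum_congr rfl fun j _ => integral_const_mul _ _
    rw [hexp]
    set G : ι → ι → ℝ := fun i j => |∫ ω, u i ω * u j ω ∂ν| with hG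
    have hGsymm : ∀ i j, G i j = G j i := fun i j => by
      simp only [hG]
      rw [show (fun ω => u i ω * u j ω) = fun ω => u j ω * u i ω from funext fun ω => mul_comm _ _]
    have hterm : ∀ i j, c i * c j * ∫ ω, u i ω * u j ω ∂ν ≤ c i ^ 2 / 2 * G i j + c j ^ 2 / 2 * G i j := by
      intro i j
      calc c i * c j * ∫ ω, u i ω * u j ω ∂ν ≤ |c i * c j * ∫ ω, u i ω * u j ω ∂ν| := le_abs_self _
        _ = |c i| * |c j| * G i j := by rw [abs_mul, abs_mul]
        _ ≤ (c i ^ 2 / 2 + c j ^ 2 / 2) * G i j := by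
            refine mul_le_mul_of_nonneg_right ?_ (abs_nonneg _)
            nlinarith [sq_nonneg (|c i| - |c j|), sq_abs (c i), sq_abs (c j)]
        _ = c i ^ 2 / 2 * G i j + c j ^ 2 / 2 * G i j := by ring
    have hrow1 : ∑ i ∈ s, ∑ j ∈ s, c i ^ 2 / 2 * G i j ≤ Λ * T / 2 := by
      calc ∑ i ∈ s, ∑ j ∈ s, c i ^ 2 / 2 * G i j = ∑ i ∈ s, c i ^ 2 / 2 * ∑ j ∈ s, G i j := by
            simp_rw [mul_sum]
        _ ≤ ∑ i ∈ s, c i ^ 2 / 2 * Λ :=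
            sum_le_sum fun i hi => mul_le_mul_of_nonneg_left (hrow i hi) (by positivity)
        _ = Λ * T / 2 := by rw [hT, ← sum_mul, ← sum_div, mul_div_assoc, mul_comm]
    have hrow2 : ∑ i ∈ s, ∑ j ∈ s, c j ^ 2 / 2 * G i j ≤ Λ * T / 2 := by
      rw [sum_comm]
      calc ∑ j ∈ s, ∑ i ∈ s, c j ^ 2 / 2 * G i j = ∑ j ∈ s, c j ^ 2 / 2 * ∑ i ∈ s, G i j := by
            simp_rw [mul_sum]
        _ ≤ ∑ j ∈ s, c j ^ 2 / 2 * Λ := by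
            refine sum_le_sum fun j hj => mul_le_mul_of_nonneg_left ?_ (by positivity)
            calc ∑ i ∈ s, G i j = ∑ i ∈ s, G j i := sum_congr rfl fun i _ => hGsymm i j
              _ ≤ Λ := hrow j hj
        _ = Λ * T / 2 := by rw [hT, ← sum_mul, ← sum_div, mul_div_assoc, mul_comm]
    calc ∑ i ∈ s, ∑ j ∈ s, c i * c j * ∫ ω, u i ω * u j ω ∂ν
        ≤ ∑ i ∈ s, ∑ j ∈ s, (c i ^ 2 / 2 * G i j + c j ^ 2 / 2 * G i j) :=
          sum_le_sum fun i _ => sum_le_sum fun j _ => hterm i j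
      _ = (∑ i ∈ s, ∑ j ∈ s, c i ^ 2 / 2 * G i j) + ∑ i ∈ s, ∑ j ∈ s, c j ^ 2 / 2 * G i j := by
          rw [← sum_add_distrib]; exact sum_congr rfl fun i _ => sum_add_distrib
      _ ≤ Λ * T / 2 + Λ * T / 2 := add_le_add hrow1 hrow2
      _ = Λ * T := by ring
  -- Cauchy–Schwarz: `T² ≤ ∫ w² · ∫ z² ≤ ∫ w² · Λ T`
  have hcs : T ^ 2 ≤ (∫ ω, w ω ^ 2 ∂ν) * (Λ * T) := by
    rw [hTz]
    refine (sq_integral_mul_le ν hwm hzm hMw hzb).trans ?_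
    rw [← hTz]
    exact mul_le_mul_of_nonneg_left hzz (integral_nonneg fun ω => sq_nonneg _)
  -- conclude `T ≤ Λ ∫ w²`
  have hw2 : 0 ≤ ∫ ω, w ω ^ 2 ∂ν := integral_nonneg fun ω => sq_nonneg _
  rcases hT0.lt_or_eq with hTpos | hTzero
  · have : T * T ≤ (Λ * ∫ ω, w ω ^ 2 ∂ν) * T := by nlinarith
    exact le_of_mul_le_mul_right this hTpos
  · rw [← hTzero]
    exact mul_nonneg hΛ hw2

end Bessel


/-- `∫ f g − ∫ f ∫ g = ∫ (f − ∫ f)(g − ∫ g)` on a probability space (bounded measurable `f, g`). -/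
theorem integral_mul_sub_eq_centred {Ω : Type*} [MeasurableSpace Ω] (ν : Measure Ω) [IsProbabilityMeasure ν]
    {f g : Ω → ℝ} (hf : Measurable f) (hg : Measurable g) {Cf Cg : ℝ}
    (hCf : ∀ ω, |f ω| ≤ Cf) (hCg : ∀ ω, |g ω| ≤ Cg) :
    (∫ ω, f ω * g ω ∂ν) - (∫ ω, f ω ∂ν) * (∫ ω, g ω ∂ν) =
      ∫ ω, (f ω - ∫ ω', f ω' ∂ν) * (g ω - ∫ ω', g ω' ∂ν) ∂ν := by
  have hfi : Integrable f ν := integrable_of_abs_le_const ν hf hCf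
  have hgi : Integrable g ν := integrable_of_abs_le_const ν hg hCg
  have hfg : Integrable (fun ω => f ω * g ω) ν :=
    integrable_of_abs_le_const ν (hf.mul hg) (M := Cf * Cg) fun ω => by
      rw [abs_mul]; exact mul_le_mul (hCf ω) (hCg ω) (abs_nonneg _) ((abs_nonneg _).trans (hCf ω))
  set a := ∫ ω', f ω' ∂ν
  set b := ∫ ω', g ω' ∂ν
  have hpt : (fun ω => (f ω - a) * (g ω - b)) = fun ω => f ω * g ω - b * f ω - a * g ω + a * b := by
    funext ω; ring
  have h1 : Integrable (fun ω => b * f ω) ν := hfi.const_mul b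
  have h2 : Integrable (fun ω => a * g ω) ν := hgi.const_mul a
  have h3 : Integrable (fun ω => f ω * g ω - b * f ω) ν := hfg.sub h1
  have h4 : Integrable (fun ω => f ω * g ω - b * f ω - a * g ω) ν := h3.sub h2
  rw [hpt, integral_add h4 (integrable_const _), integral_sub h3 h2, integral_sub hfg h1, integral_const_mul,
    integral_const_mul, integral_const, probReal_univ, one_smul]
  ring

/-- `∫ f² − (∫ f)² = ∫ (f − ∫ f)²` on a probability space. -/
theorem integral_sq_sub_sq_integral {Ω : Type*} [MeasurableSpace Ω] (ν : Measure Ω) [IsProbabilityMeasure ν]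
    {f : Ω → ℝ} (hf : Measurable f) {Cf : ℝ} (hCf : ∀ ω, |f ω| ≤ Cf) :
    (∫ ω, f ω ^ 2 ∂ν) - (∫ ω, f ω ∂ν) ^ 2 = ∫ ω, (f ω - ∫ ω', f ω' ∂ν) ^ 2 ∂ν := by
  have h := integral_mul_sub_eq_centred ν hf hf hCf hCf
  simp_rw [← pow_two] at h
  exact h


/-! ## §2 Kernel averages `γ_Λ f` of a specification: measurability, locality, pull-out, DLR -/

section Kernel

variable {V S : Type*} [MeasurableSpace S] {γ : Specification V S}

-- adapted from `Theorems/IR/AfPincerUcPortSpec.lean` (`dependsOn_of_measurable_cylinderEvents'`)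
/-- A `cylinderEvents Δ`-measurable function into a space with measurable singletons depends only on the coordinates
in `Δ` (Mathlib `Measurable.factorsThrough`). -/
theorem dependsOn_of_measurable_cylinderEvents_singleton {Z : Type*} [MeasurableSpace Z]
    [MeasurableSingletonClass Z] {Δ : Set V} {g : (V → S) → Z}
    (hg : Measurable[cylinderEvents (X := fun _ : V => S) Δ] g) : DependsOn g Δ := by
  have hle : cylinderEvents (X := fun _ : V => S) Δ ≤
      MeasurableSpace.comap (Set.restrict Δ) (MeasurableSpace.pi) := by
    refine iSup₂_le fun i hi => ?_
    have : (fun σ : V → S => σ i) = (fun η : Δ → S => η ⟨i, hi⟩) ∘ Set.restrict Δ := rfl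
    rw [this, ← MeasurableSpace.comap_comp]
    exact MeasurableSpace.comap_mono (measurable_pi_apply _).comap_le
  exact dependsOn_iff_factorsThrough.2 (hg.mono hle le_rfl).factorsThrough

/-- **Kernel locality (outside measurability):** `γ_Λ(·|η)` does not depend on the spins of `η` inside `Λ`. -/
theorem kernel_update_of_mem [DecidableEq V] (hγ : IsSpecification γ) {Λ : Finset V} {x : V} (hx : x ∈ Λ)
    (η : V → S) (s : S) :
    γ Λ (update η x s) = γ Λ η := by
  ext A hA
  have hdep := dependsOn_of_measurable_cylinderEvents_singleton (hγ.measurable Λ A hA)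
  exact hdep fun z hz => update_of_ne (by rintro rfl; exact hz (Finset.mem_coe.2 hx)) _ _

/-- `γ_Λ f` is measurable for measurable `f` (Mathlib `StronglyMeasurable.integral_kernel`). -/
theorem measurable_kernelAvg (hγ : IsSpecification γ) (Λ : Finset V) {f : (V → S) → ℝ} (hf : Measurable f) :
    Measurable fun η => ∫ σ, f σ ∂(γ Λ η) := by
  let κ : Kernel (V → S) (V → S) := ⟨γ Λ, hγ.measurable_fun Λ⟩
  exact (hf.stronglyMeasurable.integral_kernel (κ := κ)).measurable

/-- **Pull-out (properness):** `γ_Λ(F · g)(η) = g(η) · γ_Λ F(η)` when `g` reads only `Λᶜ`. -/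
theorem integral_kernel_mul_of_dependsOn_compl (hγ : IsSpecification γ) (Λ : Finset V) (η : V → S)
    {F g : (V → S) → ℝ} (hg : DependsOn g ((↑Λ : Set V)ᶜ)) :
    ∫ σ, F σ * g σ ∂(γ Λ η) = g η * ∫ σ, F σ ∂(γ Λ η) := by
  rw [mul_comm (g η), ← integral_mul_const]
  refine integral_congr_ae ?_
  filter_upwards [hγ.proper Λ η] with σ hσ
  rw [hg fun z hz => hσ z (fun h => hz (Finset.mem_coe.2 h))]

variable {μ : Measure (V → S)}

/-- **DLR for the kernel average against a `Λᶜ`-local weight:** `∫ (γ_Λ F) g dμ = ∫ F g dμ`. -/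
theorem integral_kernelAvg_mul (hγ : IsSpecification γ) (hμ : IsGibbsMeasure γ μ) (Λ : Finset V)
    {F g : (V → S) → ℝ} (hFm : Measurable F) (hgm : Measurable g) {MF Mg : ℝ} (hMF : ∀ σ, |F σ| ≤ MF)
    (hMg : ∀ σ, |g σ| ≤ Mg) (hg : DependsOn g ((↑Λ : Set V)ᶜ)) :
    ∫ η, (∫ σ, F σ ∂(γ Λ η)) * g η ∂μ = ∫ σ, F σ * g σ ∂μ := by
  haveI := hμ.isProbabilityMeasure
  have hFg : Integrable (fun σ => F σ * g σ) μ :=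
    integrable_of_abs_le_const μ (hFm.mul hgm) (M := MF * Mg) fun σ => by
      rw [abs_mul]; exact mul_le_mul (hMF σ) (hMg σ) (abs_nonneg _) ((abs_nonneg _).trans (hMF σ))
  rw [← hμ.integral_integral_eq hγ Λ hFg]
  refine integral_congr_ae (ae_of_all _ fun η => ?_)
  show (∫ σ, F σ ∂(γ Λ η)) * g η = ∫ σ, F σ * g σ ∂(γ Λ η)
  rw [integral_kernel_mul_of_dependsOn_compl hγ Λ η hg, mul_comm]

/-- `∫ γ_Λ F dμ = ∫ F dμ` (DLR). -/
theorem integral_kernelAvg (hγ : IsSpecification γ) (hμ : IsGibbsMeasure γ μ) (Λ : Finset V)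
    {F : (V → S) → ℝ} (hFm : Measurable F) {MF : ℝ} (hMF : ∀ σ, |F σ| ≤ MF) :
    ∫ η, (∫ σ, F σ ∂(γ Λ η)) ∂μ = ∫ σ, F σ ∂μ := by
  haveI := hμ.isProbabilityMeasure
  exact hμ.integral_integral_eq hγ Λ (integrable_of_abs_le_const μ hFm hMF)

/-- `∫ Var_{γ_Λ(η)}(F) dμ(η) ≤ Var_μ(F)`: conditioning lowers the mean variance (`μ(h²) ≥ μ(h)²` for `h = γ_Λ F`). -/
theorem integral_kernelVar_le (hγ : IsSpecification γ) (hμ : IsGibbsMeasure γ μ) (Λ : Finset V)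
    {F : (V → S) → ℝ} (hFm : Measurable F) {MF : ℝ} (hMF : ∀ σ, |F σ| ≤ MF) :
    ∫ η, ((∫ σ, F σ ^ 2 ∂(γ Λ η)) - (∫ σ, F σ ∂(γ Λ η)) ^ 2) ∂μ ≤
      ∫ σ, (F σ - ∫ τ, F τ ∂μ) ^ 2 ∂μ := by
  haveI := hμ.isProbabilityMeasure
  have hF2m : Measurable fun σ => F σ ^ 2 := hFm.pow_const 2
  have hF2b : ∀ σ, |F σ ^ 2| ≤ MF ^ 2 := fun σ => by
    rw [abs_pow]; exact pow_le_pow_left₀ (abs_nonneg _) (hMF σ) 2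
  set h : (V → S) → ℝ := fun η => ∫ σ, F σ ∂(γ Λ η) with hh
  have hhm : Measurable h := measurable_kernelAvg hγ Λ hFm
  have hhb : ∀ η, |h η| ≤ MF := hγ.abs_integral_le Λ hMF
  have h1 : Integrable (fun η => ∫ σ, F σ ^ 2 ∂(γ Λ η)) μ :=
    integrable_of_abs_le_const μ (measurable_kernelAvg hγ Λ hF2m) (hγ.abs_integral_le Λ hF2b)
  have h2 : Integrable (fun η => h η ^ 2) μ :=
    integrable_of_abs_le_const μ (hhm.pow_const 2) (M := MF ^ 2) fun η => by
      rw [abs_pow]; exact pow_le_pow_left₀ (abs_nonneg _) (hhb η) 2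
  rw [integral_sub h1 h2, integral_kernelAvg hγ hμ Λ hF2m hF2b, ← integral_sq_sub_sq_integral μ hFm hMF]
  -- `μ(h²) ≥ μ(h)² = μ(F)²`
  have hmean : ∫ η, h η ∂μ = ∫ σ, F σ ∂μ := integral_kernelAvg hγ hμ Λ hFm hMF
  have hjensen : (∫ η, h η ∂μ) ^ 2 ≤ ∫ η, h η ^ 2 ∂μ := by
    have := integral_sq_sub_sq_integral μ hhm hhb
    have h0 : 0 ≤ ∫ η, (h η - ∫ η', h η' ∂μ) ^ 2 ∂μ := integral_nonneg fun η => sq_nonneg _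
    linarith
  rw [hmean] at hjensen
  linarith

end Kernel

end Summit.QuantumFields.YangMills.Cruxes.IR.ShellMaxCorr.HeatBath

end
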